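import Summits.QuantumFields.YangMills.Theorems.SwapVirialDeficitNearFlatSigmaWords
import HarnessLib

/-!
# THE σ-WORD HALF OF THE NEAR-FLAT PROJECTION: a coaxial leader triple and ANY unit seam with small σ-words are `4ε`-close to an EXACTLY FLAT tuple
# (free-hands support of ⟨stmt-QuantumFields-24197⟩ `SwapVirialDeficit.SwapGluedStiffness`; LEAD g98's plan of record memo7 §C(c) «near-flat projection lemma,
# Hölder 1/4 suffices», steps (iii)–(v) of width seat w3 g66's sketch MINUS the coaxialization step (ii) = ✓`NearFlat.exists_coaxial_near`; part 2: the models)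

Letters from part 1 (✓`…NearFlatSigmaWords`): for a pure unit axis `v`, a unit seam `c` and the coaxial unit triple `C_μ = r_μ + t_μ·v`,
`‖cC₁ − C₀c‖² = A·P + B·Q`, `‖cC₀ − C₁c‖² = A·P + B·Q`, `‖cC₂ − C₂c‖² = 4t₂²·Q` with `A = |C₁ − C₀|²`, `B = |C₁ − C̄₀|²`, `P = ‖c_∥‖²`, `Q = ‖c_⊥‖²`, `P + Q = 1`,
and the two projections of the seam (coaxial: cost `2√Q`; orthogonal = Weyl reflection: cost `2√P`).  Here:
* §4 the flat models — `exists_flat_trivial` (`ε ≥ 1`: the tuple `(1,1,1,1)`), ★ `exists_flat_corner` (near-central triple `t₀², A, t₂² ≤ ε²`: `C₀, C₁ ↦` the SAME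
  central corner `σ₀`, `C₂ ↦ σ₂`, seam kept — central leaders are flat under any seam), ★ `exists_flat_stratumA` (`Q, A ≤ ε²`: seam ↦ coaxial projection, `C₁ ↦ C₀`),
  ★ `exists_flat_stratumB` (`P, B, t₂² ≤ ε²`: seam ↦ orthogonal projection `c′`, `C₁ ↦ C̄₀ = c′⁻¹C₀c′`, `C₂ ↦ ±1`); the real casework `nearFlat_real_casework`
  (`P ≥ ½ ⟹ A ≤ ε⁴` and [`Q ≤ ε²` or `2B + 4t₂² ≤ ε²`]; `Q ≥ ½ ⟹ B, 2t₂² ≤ ε⁴` and [`P ≤ ε²` or `2A ≤ ε²`]);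
* ★★ `exists_flat_near_of_coax`: `‖cC₁ − C₀c‖² + ‖cC₀ − C₁c‖² + ‖cC₂ − C₂c‖² ≤ ε⁴` ⟹ an exactly flat UNIT tuple `(c′, C′₀, C′₁, C′₂)` — `C′_μ` pairwise commuting,
  `c′C′₁ = C′₀c′`, `c′C′₀ = C′₁c′`, `c′C′₂ = C′₂c′` (the clauses of ✓`chartDeficit_eq_zero_iff` read in `ℍ`) — with `‖c − c′‖, ‖C_μ − C′_μ‖ ≤ 4ε` (Hölder `1/4` in
  the sum of squares; sharp at the crossing `Σ` of the strata, where `P ≈ Q` and all leaders are near-central);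
* §5 ★ `exists_flat_corner_general` — step (iii) for a NON-coaxial near-central triple (`‖im C₀‖, ‖im C₂‖, ‖cC₁ − C₀c‖ ≤ ε`; nothing on `im C₁`:
  `‖C₁ − σ₀‖ = ‖c(C₁ − σ₀)‖ ≤ ‖cC₁ − C₀c‖ + ‖C₀ − σ₀‖`).
* §6 (appended) ★★ `exists_flat_near_of_im_smul` — the same in the letters of ✓`exists_coaxial_tuple` (`im C_μ = t_μ • w`, one pure `w ≠ 0`; unit `c, C_μ`),
  via `coax_letters_of_im_eq_smul` (`C = re C + (t‖w‖)·(w/‖w‖)`, `re² + (t‖w‖)² = 1`).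
ASSEMBLY LEFT TO THE CONSUMER (w3 / LEAD): heaviest leader `h` of the TRIPLE with `‖im C_h‖ ≥ r` ⟹ ✓`exists_coaxial_near` for the other two (Lipschitz `1/r`),
transfer of the σ-words (`‖cC′₁ − C′₀c‖ ≤ ‖cC₁ − C₀c‖ + ‖C′₁ − C₁‖ + ‖C′₀ − C₀‖` for unit `c`), then `exists_flat_near_of_coax` with `v = im C_h/‖im C_h‖`,
`t_μ·v = im C′_μ`; if all `‖im C_μ‖ < r`, §5 directly; finally the route's `SU2 ↔ ℍ` bridge (`quatToSU2`, `frobNorm`).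

HONEST LABEL: elementary quaternion geometry; stubs B ∕ core ∕ 001 of skeleton ➎, ⟨24197⟩ ∕ ⟨24194⟩ ∕ ⟨24497⟩ OPEN; own crux ⟨22884⟩ `LargeFieldMassRefinementTail`
OPEN (blocked-on ⟨19935⟩); the Yang–Mills mass gap is NOT proved; no summit is proved by a line.  THEOREMS ONLY (0 `def`, 0 `sorry`), standard axioms.
LEAD seat ym-line-sfw-p2 g99 (cell ym-idea-1, free hands), `--supports stmt-QuantumFields-24197`.  References: [folklore].
-/

set_option autoImplicit false

noncomputable section

open Quaternion
open scoped Quaternion RealInnerProductSpace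
open Literature.MathematicalPhysics.QuantumLattice (sq_norm_eq_sum_sq)
open Summit.QuantumFields.YangMills.Theorems.VirialFluxGap.AnchorSlice (norm_coe_add_smul_pure_sq)

namespace Summit.QuantumFields.YangMills.Theorems.SwapVirialDeficit.NearFlat

/-! ## §4 The three flat models near a coaxial triple, and the projection theorem

Throughout: a pure unit axis `v`, the coaxial unit triple `C_μ = r_μ + t_μ·v` (`r_μ² + t_μ² = 1`, `μ = 0, 1, 2`), a unit seam `c`; the conclusion is always
an EXACTLY FLAT tuple `(c′, C′₀, C′₁, C′₂)` of unit quaternions — pairwise commuting `C′_μ`, `c′C′₁ = C′₀c′`, `c′C′₀ = C′₁c′`, `c′C′₂ = C′₂c′` (the clauses of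
✓`chartDeficit_eq_zero_iff` read in `ℍ`) — with every move `≤ 4ε`. -/

/-- THE TRIVIAL MODEL (`ε ≥ 1`): the tuple `(1, 1, 1, 1)` is flat and within `2 ≤ 4ε` of everything unit. [folklore] -/
theorem exists_flat_trivial {v : ℍ} (hv : v.re = 0) (hv1 : ‖v‖ = 1) {c : ℍ} (hc : ‖c‖ = 1) {r₀ t₀ r₁ t₁ r₂ t₂ : ℝ}
    (h0 : r₀ ^ 2 + t₀ ^ 2 = 1) (h1 : r₁ ^ 2 + t₁ ^ 2 = 1) (h2 : r₂ ^ 2 + t₂ ^ 2 = 1) {ε : ℝ} (hε : 1 ≤ ε) :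
    ∃ c' C₀' C₁' C₂' : ℍ, ‖c'‖ = 1 ∧ ‖C₀'‖ = 1 ∧ ‖C₁'‖ = 1 ∧ ‖C₂'‖ = 1 ∧
      C₀' * C₁' = C₁' * C₀' ∧ C₀' * C₂' = C₂' * C₀' ∧ C₁' * C₂' = C₂' * C₁' ∧
      c' * C₁' = C₀' * c' ∧ c' * C₀' = C₁' * c' ∧ c' * C₂' = C₂' * c' ∧
      ‖c - c'‖ ≤ 4 * ε ∧ ‖((r₀ : ℍ) + t₀ • v) - C₀'‖ ≤ 4 * ε ∧ ‖((r₁ : ℍ) + t₁ • v) - C₁'‖ ≤ 4 * ε ∧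
        ‖((r₂ : ℍ) + t₂ • v) - C₂'‖ ≤ 4 * ε := by
  have hn : ∀ {r t : ℝ}, r ^ 2 + t ^ 2 = 1 → ‖((r : ℍ) + t • v) - 1‖ ≤ 4 * ε := by
    intro r t h
    calc ‖((r : ℍ) + t • v) - 1‖ ≤ ‖(r : ℍ) + t • v‖ + ‖(1 : ℍ)‖ := norm_sub_le _ _
      _ = 2 := by rw [norm_eq_one_of_sq (by rw [norm_coe_add_smul_pure_sq hv hv1, h]), norm_one]; norm_num
      _ ≤ 4 * ε := by linarith
  have hcn : ‖c - 1‖ ≤ 4 * ε := by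
    calc ‖c - 1‖ ≤ ‖c‖ + ‖(1 : ℍ)‖ := norm_sub_le _ _
      _ = 2 := by rw [hc, norm_one]; norm_num
      _ ≤ 4 * ε := by linarith
  exact ⟨1, 1, 1, 1, norm_one, norm_one, norm_one, norm_one, rfl, rfl, rfl, rfl, rfl, rfl, hcn, hn h0, hn h1, hn h2⟩

/-- ★ THE CORNER MODEL (all three leaders near-central: `t₀², |C₁ − C₀|², t₂² ≤ ε²`): keep the seam, send `C₀, C₁` to the SAME central corner `σ₀ = ±1` of
`C₀` and `C₂` to its own corner `σ₂` — central leaders are flat under ANY seam. [folklore] -/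
theorem exists_flat_corner {v : ℍ} (hv : v.re = 0) (hv1 : ‖v‖ = 1) {c : ℍ} (hc : ‖c‖ = 1) {r₀ t₀ r₁ t₁ r₂ t₂ : ℝ}
    (h0 : r₀ ^ 2 + t₀ ^ 2 = 1) (h2 : r₂ ^ 2 + t₂ ^ 2 = 1) {ε : ℝ} (hε : 0 ≤ ε)
    (ht₀ : t₀ ^ 2 ≤ ε ^ 2) (ha : (r₁ - r₀) ^ 2 + (t₁ - t₀) ^ 2 ≤ ε ^ 2) (ht₂ : t₂ ^ 2 ≤ ε ^ 2) :
    ∃ c' C₀' C₁' C₂' : ℍ, ‖c'‖ = 1 ∧ ‖C₀'‖ = 1 ∧ ‖C₁'‖ = 1 ∧ ‖C₂'‖ = 1 ∧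
      C₀' * C₁' = C₁' * C₀' ∧ C₀' * C₂' = C₂' * C₀' ∧ C₁' * C₂' = C₂' * C₁' ∧
      c' * C₁' = C₀' * c' ∧ c' * C₀' = C₁' * c' ∧ c' * C₂' = C₂' * c' ∧
      ‖c - c'‖ ≤ 4 * ε ∧ ‖((r₀ : ℍ) + t₀ • v) - C₀'‖ ≤ 4 * ε ∧ ‖((r₁ : ℍ) + t₁ • v) - C₁'‖ ≤ 4 * ε ∧
        ‖((r₂ : ℍ) + t₂ • v) - C₂'‖ ≤ 4 * ε := by
  obtain ⟨σ₀, hσ₀, d₀⟩ := exists_central_near_coax hv hv1 h0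
  obtain ⟨σ₂, hσ₂, d₂⟩ := exists_central_near_coax hv hv1 h2
  have hε4 : 0 ≤ 4 * ε := by positivity
  have e₀ : ‖((r₀ : ℍ) + t₀ • v) - (σ₀ : ℍ)‖ ≤ 2 * ε := norm_le_of_sq_le (by positivity) (by nlinarith)
  have e₂ : ‖((r₂ : ℍ) + t₂ • v) - (σ₂ : ℍ)‖ ≤ 4 * ε := norm_le_of_sq_le hε4 (by nlinarith)
  have e₁₀ : ‖((r₁ : ℍ) + t₁ • v) - ((r₀ : ℍ) + t₀ • v)‖ ≤ ε :=
    norm_le_of_sq_le hε (by rw [sq_norm_coax_sub_coax hv hv1]; exact ha)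
  have e₁ : ‖((r₁ : ℍ) + t₁ • v) - (σ₀ : ℍ)‖ ≤ 4 * ε := by
    calc ‖((r₁ : ℍ) + t₁ • v) - (σ₀ : ℍ)‖
        = ‖(((r₁ : ℍ) + t₁ • v) - ((r₀ : ℍ) + t₀ • v)) + (((r₀ : ℍ) + t₀ • v) - (σ₀ : ℍ))‖ := by congr 1; abel
      _ ≤ ‖((r₁ : ℍ) + t₁ • v) - ((r₀ : ℍ) + t₀ • v)‖ + ‖((r₀ : ℍ) + t₀ • v) - (σ₀ : ℍ)‖ := norm_add_le _ _
      _ ≤ 4 * ε := by linarith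
  have hcc : ‖c - c‖ ≤ 4 * ε := by rw [sub_self, norm_zero]; exact hε4
  exact ⟨c, σ₀, σ₀, σ₂, hc, norm_coe_of_sq_eq_one hσ₀, norm_coe_of_sq_eq_one hσ₀, norm_coe_of_sq_eq_one hσ₂, rfl,
    coe_comm σ₀ _, coe_comm σ₀ _, (coe_comm σ₀ c).symm, (coe_comm σ₀ c).symm, (coe_comm σ₂ c).symm, hcc, e₀.trans (by linarith), e₁, e₂⟩

/-- ★ THE STRATUM-A MODEL (seam nearly coaxial: B-weight `Q ≤ ε²`, and `|C₁ − C₀|² ≤ ε²`): seam ↦ its coaxial projection, `C₁ ↦ C₀`, `C₂` kept — everything in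
the `v`-torus, `C′₀ = C′₁`. [folklore] -/
theorem exists_flat_stratumA {v : ℍ} (hv : v.re = 0) (hv1 : ‖v‖ = 1) {c : ℍ} (hc : ‖c‖ = 1) {r₀ t₀ r₁ t₁ r₂ t₂ : ℝ}
    (h0 : r₀ ^ 2 + t₀ ^ 2 = 1) (h2 : r₂ ^ 2 + t₂ ^ 2 = 1) {ε : ℝ} (hε : 0 ≤ ε)
    (hP : 0 < c.re ^ 2 + ⟪c.im, v⟫ ^ 2) (hQ : ‖c.im‖ ^ 2 - ⟪c.im, v⟫ ^ 2 ≤ ε ^ 2) (ha : (r₁ - r₀) ^ 2 + (t₁ - t₀) ^ 2 ≤ ε ^ 2) :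
    ∃ c' C₀' C₁' C₂' : ℍ, ‖c'‖ = 1 ∧ ‖C₀'‖ = 1 ∧ ‖C₁'‖ = 1 ∧ ‖C₂'‖ = 1 ∧
      C₀' * C₁' = C₁' * C₀' ∧ C₀' * C₂' = C₂' * C₀' ∧ C₁' * C₂' = C₂' * C₁' ∧
      c' * C₁' = C₀' * c' ∧ c' * C₀' = C₁' * c' ∧ c' * C₂' = C₂' * c' ∧
      ‖c - c'‖ ≤ 4 * ε ∧ ‖((r₀ : ℍ) + t₀ • v) - C₀'‖ ≤ 4 * ε ∧ ‖((r₁ : ℍ) + t₁ • v) - C₁'‖ ≤ 4 * ε ∧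
        ‖((r₂ : ℍ) + t₂ • v) - C₂'‖ ≤ 4 * ε := by
  obtain ⟨r, t, hrt, hdist⟩ := exists_coax_unit_near hv hv1 hc hP
  have hε4 : 0 ≤ 4 * ε := by positivity
  have hsq : Real.sqrt (‖c.im‖ ^ 2 - ⟪c.im, v⟫ ^ 2) ≤ ε := by
    calc Real.sqrt (‖c.im‖ ^ 2 - ⟪c.im, v⟫ ^ 2) ≤ Real.sqrt (ε ^ 2) := Real.sqrt_le_sqrt hQ
      _ = ε := Real.sqrt_sq hε
  have dc : ‖c - ((r : ℍ) + t • v)‖ ≤ 4 * ε := hdist.trans (by linarith)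
  have d00 : ‖((r₀ : ℍ) + t₀ • v) - ((r₀ : ℍ) + t₀ • v)‖ ≤ 4 * ε := by rw [sub_self, norm_zero]; exact hε4
  have d22 : ‖((r₂ : ℍ) + t₂ • v) - ((r₂ : ℍ) + t₂ • v)‖ ≤ 4 * ε := by rw [sub_self, norm_zero]; exact hε4
  have d10 : ‖((r₁ : ℍ) + t₁ • v) - ((r₀ : ℍ) + t₀ • v)‖ ≤ 4 * ε :=
    norm_le_of_sq_le hε4 (by rw [sq_norm_coax_sub_coax hv hv1]; nlinarith)
  exact ⟨(r : ℍ) + t • v, (r₀ : ℍ) + t₀ • v, (r₀ : ℍ) + t₀ • v, (r₂ : ℍ) + t₂ • v,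
    norm_eq_one_of_sq (by rw [norm_coe_add_smul_pure_sq hv hv1, hrt]), norm_eq_one_of_sq (by rw [norm_coe_add_smul_pure_sq hv hv1, h0]),
    norm_eq_one_of_sq (by rw [norm_coe_add_smul_pure_sq hv hv1, h0]), norm_eq_one_of_sq (by rw [norm_coe_add_smul_pure_sq hv hv1, h2]),
    rfl, coax_comm v _ _ _ _, coax_comm v _ _ _ _, coax_comm v _ _ _ _, coax_comm v _ _ _ _, coax_comm v _ _ _ _,
    dc, d00, d10, d22⟩

/-- ★ THE STRATUM-B MODEL (seam nearly orthogonal: A-weight `P ≤ ε²`, `|C₁ − C̄₀|² ≤ ε²`, `t₂² ≤ ε²`): seam ↦ its orthogonal projection `c′` (a pure unit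
anticommuting with the axis), `C₁ ↦ C̄₀ = r₀ − t₀v`, `C₂ ↦` its central corner — the Weyl-reflected valley `C′₁ = c′⁻¹C′₀c′ = C̄′₀`, `C′₂ = ±1`. [folklore] -/
theorem exists_flat_stratumB {v : ℍ} (hv : v.re = 0) (hv1 : ‖v‖ = 1) {c : ℍ} (hc : ‖c‖ = 1) {r₀ t₀ r₁ t₁ r₂ t₂ : ℝ}
    (h0 : r₀ ^ 2 + t₀ ^ 2 = 1) (h2 : r₂ ^ 2 + t₂ ^ 2 = 1) {ε : ℝ} (hε : 0 ≤ ε)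
    (hQ : 0 < ‖c.im‖ ^ 2 - ⟪c.im, v⟫ ^ 2) (hP : c.re ^ 2 + ⟪c.im, v⟫ ^ 2 ≤ ε ^ 2)
    (hab : (r₁ - r₀) ^ 2 + (t₁ + t₀) ^ 2 ≤ ε ^ 2) (ht₂ : t₂ ^ 2 ≤ ε ^ 2) :
    ∃ c' C₀' C₁' C₂' : ℍ, ‖c'‖ = 1 ∧ ‖C₀'‖ = 1 ∧ ‖C₁'‖ = 1 ∧ ‖C₂'‖ = 1 ∧
      C₀' * C₁' = C₁' * C₀' ∧ C₀' * C₂' = C₂' * C₀' ∧ C₁' * C₂' = C₂' * C₁' ∧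
      c' * C₁' = C₀' * c' ∧ c' * C₀' = C₁' * c' ∧ c' * C₂' = C₂' * c' ∧
      ‖c - c'‖ ≤ 4 * ε ∧ ‖((r₀ : ℍ) + t₀ • v) - C₀'‖ ≤ 4 * ε ∧ ‖((r₁ : ℍ) + t₁ • v) - C₁'‖ ≤ 4 * ε ∧
        ‖((r₂ : ℍ) + t₂ • v) - C₂'‖ ≤ 4 * ε := by
  obtain ⟨c', hc'1, -, hanti, hdist⟩ := exists_orth_unit_near hv hv1 hc hQ
  obtain ⟨σ₂, hσ₂, d₂⟩ := exists_central_near_coax hv hv1 h2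
  have hε4 : 0 ≤ 4 * ε := by positivity
  have hsq : Real.sqrt (c.re ^ 2 + ⟪c.im, v⟫ ^ 2) ≤ ε := by
    calc Real.sqrt (c.re ^ 2 + ⟪c.im, v⟫ ^ 2) ≤ Real.sqrt (ε ^ 2) := Real.sqrt_le_sqrt hP
      _ = ε := Real.sqrt_sq hε
  have dc : ‖c - c'‖ ≤ 4 * ε := hdist.trans (by linarith)
  have d00 : ‖((r₀ : ℍ) + t₀ • v) - ((r₀ : ℍ) + t₀ • v)‖ ≤ 4 * ε := by rw [sub_self, norm_zero]; exact hε4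
  have d1 : ‖((r₁ : ℍ) + t₁ • v) - ((r₀ : ℍ) + (-t₀) • v)‖ ≤ 4 * ε :=
    norm_le_of_sq_le hε4 (by rw [sq_norm_coax_sub_coax hv hv1, sub_neg_eq_add]; nlinarith)
  have e₂ : ‖((r₂ : ℍ) + t₂ • v) - (σ₂ : ℍ)‖ ≤ 4 * ε := norm_le_of_sq_le hε4 (by nlinarith)
  have hn1 : ‖(r₀ : ℍ) + (-t₀) • v‖ = 1 := norm_eq_one_of_sq (by rw [norm_coe_add_smul_pure_sq hv hv1, neg_sq, h0])
  exact ⟨c', (r₀ : ℍ) + t₀ • v, (r₀ : ℍ) + (-t₀) • v, (σ₂ : ℍ), hc'1, norm_eq_one_of_sq (by rw [norm_coe_add_smul_pure_sq hv hv1, h0]), hn1,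
    norm_coe_of_sq_eq_one hσ₂, coax_comm v _ _ _ _, (coe_comm σ₂ _).symm, (coe_comm σ₂ _).symm,
    sigmaRel_of_anticomm hanti r₀ t₀, sigmaRel_of_anticomm' hanti r₀ t₀, (coe_comm σ₂ c').symm, dc, d00, d1, e₂⟩

/-- The real casework behind the projection theorem: with `P + Q = 1`, `2(AP + BQ) + 4t₂²Q ≤ ε⁴ < 1` one of the three models applies —
stratum A (`P > 0`, `Q ≤ ε²`, `A ≤ ε²`), stratum B (`Q > 0`, `P ≤ ε²`, `B ≤ ε²`, `t₂² ≤ ε²`) or the corner (`t₀², A, t₂² ≤ ε²`). [folklore] -/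
theorem nearFlat_real_casework {P Q A B t₀ t₂ ε : ℝ} (hP0 : 0 ≤ P) (hQ0 : 0 ≤ Q) (hPQ : P + Q = 1) (hA0 : 0 ≤ A) (hB0 : 0 ≤ B)
    (ht0 : 4 * t₀ ^ 2 ≤ 2 * A + 2 * B) (hε : 0 ≤ ε) (hε1 : ε < 1)
    (hW : A * P + B * Q + (A * P + B * Q) + 4 * t₂ ^ 2 * Q ≤ ε ^ 4) :
    (0 < P ∧ Q ≤ ε ^ 2 ∧ A ≤ ε ^ 2) ∨ (0 < Q ∧ P ≤ ε ^ 2 ∧ B ≤ ε ^ 2 ∧ t₂ ^ 2 ≤ ε ^ 2) ∨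
      (t₀ ^ 2 ≤ ε ^ 2 ∧ A ≤ ε ^ 2 ∧ t₂ ^ 2 ≤ ε ^ 2) := by
  have hAP : 0 ≤ A * P := mul_nonneg hA0 hP0
  have hBQ : 0 ≤ B * Q := mul_nonneg hB0 hQ0
  have htQ : 0 ≤ t₂ ^ 2 * Q := mul_nonneg (sq_nonneg _) hQ0
  have hε2 : 0 ≤ ε ^ 2 := sq_nonneg ε
  have hε4 : ε ^ 4 = ε ^ 2 * ε ^ 2 := by ring
  have hε1' : ε ^ 2 ≤ 1 := by nlinarith
  have hε42 : ε ^ 4 ≤ ε ^ 2 := by nlinarith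
  by_cases hPhalf : 1 / 2 ≤ P
  · -- `A ≤ 2AP ≤ ε⁴`
    have hA2 : A ≤ 2 * (A * P) := by nlinarith [mul_nonneg hA0 (show 0 ≤ P - 1 / 2 by linarith)]
    have hAε : A ≤ ε ^ 4 := by linarith
    by_cases hQε : Q ≤ ε ^ 2
    · exact Or.inl ⟨by linarith, hQε, hAε.trans hε42⟩
    · have hQε' : ε ^ 2 < Q := lt_of_not_ge hQε
      -- `(2B + 4t₂²)·Q ≤ ε⁴` with `Q > ε²` forces `2B + 4t₂² ≤ ε²`
      have hXQ : (2 * B + 4 * t₂ ^ 2) * Q ≤ ε ^ 4 := by nlinarith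
      have hX : 2 * B + 4 * t₂ ^ 2 ≤ ε ^ 2 := by
        by_contra hX'
        have hlt := mul_lt_mul'' (lt_of_not_ge hX') hQε' hε2 hε2
        linarith
      exact Or.inr (Or.inr ⟨by nlinarith, hAε.trans hε42, by nlinarith⟩)
  · have hPhalf' : P < 1 / 2 := lt_of_not_ge hPhalf
    -- `B ≤ 2BQ ≤ ε⁴`, `2t₂² ≤ 4t₂²Q ≤ ε⁴`
    have hB2 : B ≤ 2 * (B * Q) := by nlinarith [mul_nonneg hB0 (show 0 ≤ Q - 1 / 2 by linarith)]
    have hBε : B ≤ ε ^ 4 := by linarith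
    have ht₂2 : 2 * t₂ ^ 2 ≤ 4 * (t₂ ^ 2 * Q) := by nlinarith [mul_nonneg (sq_nonneg t₂) (show 0 ≤ Q - 1 / 2 by linarith)]
    have ht₂ε : 2 * t₂ ^ 2 ≤ ε ^ 4 := by linarith
    by_cases hPε : P ≤ ε ^ 2
    · exact Or.inr (Or.inl ⟨by linarith, hPε, hBε.trans hε42, by nlinarith⟩)
    · have hPε' : ε ^ 2 < P := lt_of_not_ge hPε
      have hXP : (2 * A) * P ≤ ε ^ 4 := by nlinarith
      have hX : 2 * A ≤ ε ^ 2 := by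
        by_contra hX'
        have hlt := mul_lt_mul'' (lt_of_not_ge hX') hPε' hε2 hε2
        linarith
      exact Or.inr (Or.inr ⟨by nlinarith, by linarith, by nlinarith⟩)

/-- ★★ **THE σ-WORD HALF OF THE NEAR-FLAT PROJECTION.**  For a pure unit axis `v`, a unit seam `c` and a coaxial unit triple `C_μ = r_μ + t_μ·v`: if the three
σ-words are small, `‖cC₁ − C₀c‖² + ‖cC₀ − C₁c‖² + ‖cC₂ − C₂c‖² ≤ ε⁴`, then there is an EXACTLY FLAT unit tuple `(c′, C′₀, C′₁, C′₂)` — `C′_μ` pairwise commuting,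
`c′C′₁ = C′₀c′`, `c′C′₀ = C′₁c′`, `c′C′₂ = C′₂c′` — with `‖c − c′‖ ≤ 4ε` and `‖C_μ − C′_μ‖ ≤ 4ε` (Hölder exponent `1/4` in the sum of squares; optimal at the
crossing of the strata).  PROOF: by ✓`sq_norm_sigmaWord_coax_unit` the hypothesis reads `2aP + (2ā + 4t₂²)Q ≤ ε⁴` with `P + Q = 1`, `a = |C₁ − C₀|²`,
`ā = |C₁ − C̄₀|²`; if `P ≥ ½` then `a ≤ ε⁴` and either `Q ≤ ε²` (stratum-A model) or `2ā + 4t₂² ≤ ε²` (corner model); if `Q ≥ ½` then `ā, 2t₂² ≤ ε⁴` and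
either `P ≤ ε²` (stratum-B model) or `2a ≤ ε²` (corner model); `ε ≥ 1` is trivial. [folklore] -/
theorem exists_flat_near_of_coax {v : ℍ} (hv : v.re = 0) (hv1 : ‖v‖ = 1) {c : ℍ} (hc : ‖c‖ = 1) {r₀ t₀ r₁ t₁ r₂ t₂ : ℝ}
    (h0 : r₀ ^ 2 + t₀ ^ 2 = 1) (h1 : r₁ ^ 2 + t₁ ^ 2 = 1) (h2 : r₂ ^ 2 + t₂ ^ 2 = 1) {ε : ℝ} (hε : 0 ≤ ε)
    (hW : ‖c * ((r₁ : ℍ) + t₁ • v) - ((r₀ : ℍ) + t₀ • v) * c‖ ^ 2 + ‖c * ((r₀ : ℍ) + t₀ • v) - ((r₁ : ℍ) + t₁ • v) * c‖ ^ 2 +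
        ‖c * ((r₂ : ℍ) + t₂ • v) - ((r₂ : ℍ) + t₂ • v) * c‖ ^ 2 ≤ ε ^ 4) :
    ∃ c' C₀' C₁' C₂' : ℍ, ‖c'‖ = 1 ∧ ‖C₀'‖ = 1 ∧ ‖C₁'‖ = 1 ∧ ‖C₂'‖ = 1 ∧
      C₀' * C₁' = C₁' * C₀' ∧ C₀' * C₂' = C₂' * C₀' ∧ C₁' * C₂' = C₂' * C₁' ∧
      c' * C₁' = C₀' * c' ∧ c' * C₀' = C₁' * c' ∧ c' * C₂' = C₂' * c' ∧
      ‖c - c'‖ ≤ 4 * ε ∧ ‖((r₀ : ℍ) + t₀ • v) - C₀'‖ ≤ 4 * ε ∧ ‖((r₁ : ℍ) + t₁ • v) - C₁'‖ ≤ 4 * ε ∧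
        ‖((r₂ : ℍ) + t₂ • v) - C₂'‖ ≤ 4 * ε := by
  -- the trivial range first
  by_cases hε1 : 1 ≤ ε
  · exact exists_flat_trivial hv hv1 hc h0 h1 h2 hε1
  -- the three σ-words in the letters `P, Q, A = |C₁ − C₀|², B = |C₁ − C̄₀|², t₂`
  have hPQ : (c.re ^ 2 + ⟪c.im, v⟫ ^ 2) + (‖c.im‖ ^ 2 - ⟪c.im, v⟫ ^ 2) = 1 := by rw [weightA_add_weightB, hc, one_pow]
  have hQ0 : 0 ≤ ‖c.im‖ ^ 2 - ⟪c.im, v⟫ ^ 2 := weightB_nonneg hv1 c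
  have hP0 : 0 ≤ c.re ^ 2 + ⟪c.im, v⟫ ^ 2 := by positivity
  have e01 := sq_norm_sigmaWord_coax_unit hv hv1 c r₀ t₀ r₁ t₁
  have e10 : ‖c * ((r₀ : ℍ) + t₀ • v) - ((r₁ : ℍ) + t₁ • v) * c‖ ^ 2 =
      ((r₁ - r₀) ^ 2 + (t₁ - t₀) ^ 2) * (c.re ^ 2 + ⟪c.im, v⟫ ^ 2) + ((r₁ - r₀) ^ 2 + (t₁ + t₀) ^ 2) * (‖c.im‖ ^ 2 - ⟪c.im, v⟫ ^ 2) := by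
    rw [sq_norm_sigmaWord_coax_unit hv hv1]; ring
  have e2 := sq_norm_comm_coax_unit hv hv1 c r₂ t₂
  rw [e01, e10, e2] at hW
  clear e01 e10 e2
  have hA0 : 0 ≤ (r₁ - r₀) ^ 2 + (t₁ - t₀) ^ 2 := by positivity
  have hB0 : 0 ≤ (r₁ - r₀) ^ 2 + (t₁ + t₀) ^ 2 := by positivity
  have ht0 : 4 * t₀ ^ 2 ≤ 2 * ((r₁ - r₀) ^ 2 + (t₁ - t₀) ^ 2) + 2 * ((r₁ - r₀) ^ 2 + (t₁ + t₀) ^ 2) := by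
    nlinarith [sq_nonneg (r₁ - r₀), sq_nonneg t₁]
  rcases nearFlat_real_casework hP0 hQ0 hPQ hA0 hB0 ht0 hε (lt_of_not_ge hε1) hW with
    ⟨hP, hQ, hA⟩ | ⟨hQ, hP, hB, ht₂⟩ | ⟨ht₀, hA, ht₂⟩
  · exact exists_flat_stratumA hv hv1 hc h0 h2 hε hP hQ hA
  · exact exists_flat_stratumB hv hv1 hc h0 h2 hε hQ hP hB ht₂
  · exact exists_flat_corner hv hv1 hc h0 h2 hε ht₀ hA ht₂


/-! ## §5 The corner model for a GENERAL (non-coaxial) near-central triple — step (iii) of the near-flat projection -/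

/-- THE NEAREST CENTRAL CORNER of a unit quaternion: `σ = ±1` with `‖C − σ‖² ≤ 2‖im C‖²` (`= 2 − 2|re C| ≤ 2(1 − re²)`). [folklore] -/
theorem exists_central_near {C : ℍ} (hC : ‖C‖ = 1) : ∃ σ : ℝ, σ ^ 2 = 1 ∧ ‖C - (σ : ℍ)‖ ^ 2 ≤ 2 * ‖C.im‖ ^ 2 := by
  have hC2 : ‖C‖ ^ 2 = C.re ^ 2 + ‖C.im‖ ^ 2 := by
    rw [sq_norm_eq_sum_sq C, sq_norm_eq_sum_sq C.im, Quaternion.re_im, Quaternion.imI_im, Quaternion.imJ_im, Quaternion.imK_im]; ring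
  have h1 : C.re ^ 2 + ‖C.im‖ ^ 2 = 1 := by rw [← hC2, hC, one_pow]
  have key : ∀ σ : ℝ, σ ^ 2 = 1 → 0 ≤ σ * C.re → ‖C - (σ : ℍ)‖ ^ 2 ≤ 2 * ‖C.im‖ ^ 2 := by
    intro σ hσ hσr
    have e : ‖C - (σ : ℍ)‖ ^ 2 = (C.re - σ) ^ 2 + ‖C.im‖ ^ 2 := by
      have hd : ‖C - (σ : ℍ)‖ ^ 2 = (C - (σ : ℍ)).re ^ 2 + ‖(C - (σ : ℍ)).im‖ ^ 2 := by
        rw [sq_norm_eq_sum_sq (C - (σ : ℍ)), sq_norm_eq_sum_sq (C - (σ : ℍ)).im, Quaternion.re_im, Quaternion.imI_im, Quaternion.imJ_im, Quaternion.imK_im]; ring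
      rw [hd, Quaternion.re_sub, Quaternion.re_coe, Quaternion.im_sub, Quaternion.im_coe, sub_zero]
    rw [e]
    have hr1 : C.re ^ 2 ≤ 1 := by nlinarith [sq_nonneg ‖C.im‖]
    have habs : C.re ^ 2 ≤ σ * C.re := by
      have : (σ * C.re) ^ 2 = C.re ^ 2 := by rw [mul_pow, hσ, one_mul]
      nlinarith [sq_nonneg (σ * C.re - 1)]
    nlinarith
  by_cases hr : 0 ≤ C.re
  · exact ⟨1, by norm_num, key 1 (by norm_num) (by simpa using hr)⟩
  · exact ⟨-1, by norm_num, key (-1) (by norm_num) (by nlinarith [(not_le.mp hr).le])⟩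

/-- ★ **THE CORNER MODEL FOR A GENERAL NEAR-CENTRAL TRIPLE** (step (iii) of the near-flat projection: the heaviest leader is light).  Unit `c, C₀, C₁, C₂` with
`‖im C₀‖, ‖im C₂‖ ≤ ε` and ONE small σ-word `‖cC₁ − C₀c‖ ≤ ε`: keep the seam, send `C₀` AND `C₁` to the central corner `σ₀` of `C₀` (`‖C₁ − σ₀‖ = ‖c(C₁ − σ₀)‖ ≤
‖cC₁ − C₀c‖ + ‖C₀ − σ₀‖`, no hypothesis on `im C₁` needed) and `C₂` to its own corner: an exactly flat unit tuple within `4ε`. [folklore] -/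
theorem exists_flat_corner_general {c C₀ C₁ C₂ : ℍ} (hc : ‖c‖ = 1) (hC₀ : ‖C₀‖ = 1) (hC₂ : ‖C₂‖ = 1) {ε : ℝ} (hε : 0 ≤ ε)
    (h0 : ‖C₀.im‖ ≤ ε) (h2 : ‖C₂.im‖ ≤ ε) (hw : ‖c * C₁ - C₀ * c‖ ≤ ε) :
    ∃ c' C₀' C₁' C₂' : ℍ, ‖c'‖ = 1 ∧ ‖C₀'‖ = 1 ∧ ‖C₁'‖ = 1 ∧ ‖C₂'‖ = 1 ∧
      C₀' * C₁' = C₁' * C₀' ∧ C₀' * C₂' = C₂' * C₀' ∧ C₁' * C₂' = C₂' * C₁' ∧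
      c' * C₁' = C₀' * c' ∧ c' * C₀' = C₁' * c' ∧ c' * C₂' = C₂' * c' ∧
      ‖c - c'‖ ≤ 4 * ε ∧ ‖C₀ - C₀'‖ ≤ 4 * ε ∧ ‖C₁ - C₁'‖ ≤ 4 * ε ∧ ‖C₂ - C₂'‖ ≤ 4 * ε := by
  obtain ⟨σ₀, hσ₀, d₀⟩ := exists_central_near hC₀
  obtain ⟨σ₂, hσ₂, d₂⟩ := exists_central_near hC₂
  have hε4 : 0 ≤ 4 * ε := by positivity
  have e₀ : ‖C₀ - (σ₀ : ℍ)‖ ≤ 2 * ε := norm_le_of_sq_le (by positivity) (by nlinarith [norm_nonneg C₀.im])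
  have e₂ : ‖C₂ - (σ₂ : ℍ)‖ ≤ 4 * ε := norm_le_of_sq_le hε4 (by nlinarith [norm_nonneg C₂.im])
  -- `c(C₁ − σ₀) = (cC₁ − C₀c) + (C₀ − σ₀)c`
  have e₁ : ‖C₁ - (σ₀ : ℍ)‖ ≤ 4 * ε := by
    have hid : c * (C₁ - (σ₀ : ℍ)) = (c * C₁ - C₀ * c) + (C₀ - (σ₀ : ℍ)) * c := by
      rw [mul_sub, sub_mul, (coe_comm σ₀ c)]; abel
    have hn : ‖C₁ - (σ₀ : ℍ)‖ = ‖c * (C₁ - (σ₀ : ℍ))‖ := by rw [norm_mul, hc, one_mul]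
    rw [hn, hid]
    calc ‖(c * C₁ - C₀ * c) + (C₀ - (σ₀ : ℍ)) * c‖ ≤ ‖c * C₁ - C₀ * c‖ + ‖(C₀ - (σ₀ : ℍ)) * c‖ := norm_add_le _ _
      _ = ‖c * C₁ - C₀ * c‖ + ‖C₀ - (σ₀ : ℍ)‖ := by rw [norm_mul, hc, mul_one]
      _ ≤ 4 * ε := by linarith
  have hcc : ‖c - c‖ ≤ 4 * ε := by rw [sub_self, norm_zero]; exact hε4
  exact ⟨c, σ₀, σ₀, σ₂, hc, norm_coe_of_sq_eq_one hσ₀, norm_coe_of_sq_eq_one hσ₀, norm_coe_of_sq_eq_one hσ₂, rfl,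
    coe_comm σ₀ _, coe_comm σ₀ _, (coe_comm σ₀ c).symm, (coe_comm σ₀ c).symm, (coe_comm σ₂ c).symm, hcc, e₀.trans (by linarith), e₁, e₂⟩


/-! ## §6 The same in the letters of ✓`exists_coaxial_tuple` (appended, LEAD g99 2026-08-31): a triple with `im C_μ = t_μ • w` on ONE pure axis `w ≠ 0` -/

/-- A unit quaternion whose imaginary part lies on the axis `ℝ·w` (`w` pure, `w ≠ 0`) is `re C + (t‖w‖)·v` for the unit axis `v = w/‖w‖`, with
`re(C)² + (t‖w‖)² = 1`. [folklore] -/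
theorem coax_letters_of_im_eq_smul {w C : ℍ} (hw : w.re = 0) (hw0 : w ≠ 0) (hC : ‖C‖ = 1) {t : ℝ} (ht : C.im = t • w) :
    C = ((C.re : ℝ) : ℍ) + (t * ‖w‖) • (‖w‖⁻¹ • w) ∧ C.re ^ 2 + (t * ‖w‖) ^ 2 = 1 := by
  have hwn : ‖w‖ ≠ 0 := norm_ne_zero_iff.2 hw0
  have hv : (‖w‖⁻¹ • w).re = 0 := by rw [Quaternion.re_smul, hw, smul_zero]
  have hv1 : ‖(‖w‖⁻¹ • w)‖ = 1 := by rw [norm_smul, norm_inv, norm_norm, inv_mul_cancel₀ hwn]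
  have e : C = ((C.re : ℝ) : ℍ) + (t * ‖w‖) • (‖w‖⁻¹ • w) := by
    rw [smul_smul, mul_assoc, mul_inv_cancel₀ hwn, mul_one, ← ht, Quaternion.re_add_im]
  refine ⟨e, ?_⟩
  rw [← norm_coe_add_smul_pure_sq hv hv1, ← e, hC, one_pow]

/-- ★★ **THE σ-WORD HALF, IN THE LETTERS OF ✓`exists_coaxial_tuple`.**  Unit `c, C₀, C₁, C₂` with `im C_μ = t_μ • w` for one pure `w ≠ 0` (the output of the
coaxialization at the heaviest leader, `w = im C_h`): `‖cC₁ − C₀c‖² + ‖cC₀ − C₁c‖² + ‖cC₂ − C₂c‖² ≤ ε⁴` ⟹ an exactly flat unit tuple `(c′, C′₀, C′₁, C′₂)`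
(the hypotheses of ✓`flat_of_sigma_relations` with `Cf = ![C′₀, C′₁, C′₂, c′]`) within `4ε` of `(c, C₀, C₁, C₂)`. [folklore] -/
theorem exists_flat_near_of_im_smul {w c C₀ C₁ C₂ : ℍ} (hw : w.re = 0) (hw0 : w ≠ 0) (hc : ‖c‖ = 1) (hC₀ : ‖C₀‖ = 1) (hC₁ : ‖C₁‖ = 1)
    (hC₂ : ‖C₂‖ = 1) (hi₀ : ∃ t : ℝ, C₀.im = t • w) (hi₁ : ∃ t : ℝ, C₁.im = t • w) (hi₂ : ∃ t : ℝ, C₂.im = t • w) {ε : ℝ} (hε : 0 ≤ ε)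
    (hW : ‖c * C₁ - C₀ * c‖ ^ 2 + ‖c * C₀ - C₁ * c‖ ^ 2 + ‖c * C₂ - C₂ * c‖ ^ 2 ≤ ε ^ 4) :
    ∃ c' C₀' C₁' C₂' : ℍ, ‖c'‖ = 1 ∧ ‖C₀'‖ = 1 ∧ ‖C₁'‖ = 1 ∧ ‖C₂'‖ = 1 ∧
      C₀' * C₁' = C₁' * C₀' ∧ C₀' * C₂' = C₂' * C₀' ∧ C₁' * C₂' = C₂' * C₁' ∧
      c' * C₁' = C₀' * c' ∧ c' * C₀' = C₁' * c' ∧ c' * C₂' = C₂' * c' ∧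
      ‖c - c'‖ ≤ 4 * ε ∧ ‖C₀ - C₀'‖ ≤ 4 * ε ∧ ‖C₁ - C₁'‖ ≤ 4 * ε ∧ ‖C₂ - C₂'‖ ≤ 4 * ε := by
  have hwn : ‖w‖ ≠ 0 := norm_ne_zero_iff.2 hw0
  have hv : (‖w‖⁻¹ • w).re = 0 := by rw [Quaternion.re_smul, hw, smul_zero]
  have hv1 : ‖(‖w‖⁻¹ • w)‖ = 1 := by rw [norm_smul, norm_inv, norm_norm, inv_mul_cancel₀ hwn]
  obtain ⟨t₀, ht₀⟩ := hi₀
  obtain ⟨t₁, ht₁⟩ := hi₁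
  obtain ⟨t₂, ht₂⟩ := hi₂
  obtain ⟨e₀, h0⟩ := coax_letters_of_im_eq_smul hw hw0 hC₀ ht₀
  obtain ⟨e₁, h1⟩ := coax_letters_of_im_eq_smul hw hw0 hC₁ ht₁
  obtain ⟨e₂, h2⟩ := coax_letters_of_im_eq_smul hw hw0 hC₂ ht₂
  -- freeze the letters
  obtain ⟨v, hvdef⟩ : ∃ v : ℍ, ‖w‖⁻¹ • w = v := ⟨_, rfl⟩
  obtain ⟨r₀, hr₀⟩ : ∃ r : ℝ, C₀.re = r := ⟨_, rfl⟩
  obtain ⟨r₁, hr₁⟩ : ∃ r : ℝ, C₁.re = r := ⟨_, rfl⟩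
  obtain ⟨r₂, hr₂⟩ : ∃ r : ℝ, C₂.re = r := ⟨_, rfl⟩
  rw [hvdef] at hv hv1 e₀ e₁ e₂
  rw [hr₀] at e₀ h0
  rw [hr₁] at e₁ h1
  rw [hr₂] at e₂ h2
  rw [e₀, e₁, e₂] at hW
  obtain ⟨c', C₀', C₁', C₂', n, n₀, n₁, n₂, c01, c02, c12, s₁, s₀, s₂, d, d₀, d₁, d₂⟩ :=
    exists_flat_near_of_coax hv hv1 hc h0 h1 h2 hε hW
  refine ⟨c', C₀', C₁', C₂', n, n₀, n₁, n₂, c01, c02, c12, s₁, s₀, s₂, d, ?_, ?_, ?_⟩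
  · rw [e₀]; exact d₀
  · rw [e₁]; exact d₁
  · rw [e₂]; exact d₂

end Summit.QuantumFields.YangMills.Theorems.SwapVirialDeficit.NearFlat

end
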